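import Literature.MathematicalPhysics.QuantumFieldTheory.Balaban1983to89.B10Eq25WalkGeometry

/-!
# `Balaban1983to89.B10Eq25TubeLaw` — [Balaban1985UV3] p. 262, (23) ⇒ (25): THE TUBE LAW (T) for the rescaling
# sentence «if the big blocks are scaled to unit cubes» — `B10Eq25Rate.RescaleLaw` with distortion `Λ = O(s₀^{d−1})`,
# NO per-step slack (`ℓ₀ = 0`) and `ℓ₁ = O(s₀^d)`, for the CONCRETE walk distance (3.93) [5] on the window geometry of
# `B10Eq25WalkGeometry`; hence (25) with a rate LINEAR in M₁ and a κ-FREE entropy threshold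

T. Bałaban, *Ultraviolet stability of three-dimensional lattice pure gauge field theories*, Commun. Math. Phys. **102**,
255–275 (1985) [Balaban1985UV3] (cell paper B10; p. 262 = [PDF 8]); [5] = T. Bałaban, *Propagators for lattice gauge
theories in a background field*, Commun. Math. Phys. **99**, 389–434 (1985) [Balaban1985BackgroundPropagators] ((3.93)
p. 410).  The displays (23)–(25) and (3.93) are quoted verbatim in `B10Eq25Rate` and `B10Eq25WalkGeometry`; nothing of
the manuscripts is asserted here.

statement-level skeleton of published theorems with citation tags; proofs where landed; nothing here is a claim about
the Yang–Mills mass gap.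

WHY THIS FILE EXISTS (YM-DAG node N08 = [B10], -b seat `pub-ymgap-dag-n21-b` re-pointed by dag-lead
[DAGLEAD-G0-REBALANCE-7B-N08]; pub-balaban GAPS C-b10g12-1 (b)).  `B10Eq25Rate` types the rescaling sentence of p. 262 as
the hypothesis `RescaleLaw D nbrs cube dom wd M Λ ℓ₀ ℓ₁` (`M·𝓛(X(□,ω)) ≤ Λ·d(ω,□ᵢ,□ⱼ) + M(ℓ₀|ω| + ℓ₁)`) and records two
instances in the paper's geometry, «neither is typed»: the COUNT law (N) (`Λ = 0`, `ℓ₀ > 0`; rate `κ = O(log M₁)` from the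
per-step smallness) — PROVED on the window of big blocks by `B10Eq25WalkGeometry.rescaleLaw_window` (n08-b) — and the TUBE
law (T) (`ℓ₀ = 0`; rate `κ ≤ ½δ₀M₁/Λ`, LINEAR in M₁, from the exponential factor of (23): the factor print itself uses on
p. 262, «the exponential factor in (23) yields the factor exp(−R)»).  THIS FILE PROVES (T), for the CONCRETE walk distance
of [5] (3.93) («d(ω, y, y′) = inf_{(y₁,…,yₙ)}(d(y,y₁) + d(y₁,y₂) + ⋯ )», «the infimum is taken over all sequences (y₁, …, yₙ)
of points yᵢ ∈ □ᵢ»): `wdist y ω` = the least length of a chain from the block `y` through ONE block of each state of `ω`,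
block centres at sup-distance («the distance between centers of neighbouring blocks is taken to be equal to 1»), and
`wd □ ω := M·wdist □ ω` in lattice units.

THE ARGUMENT (GAPS C-b10g12-1 (b), here with a discrete r-net).  Along an optimal chain `y = y₀, y₁ ∈ X₁, …, yₙ ∈ Xₙ`
choose centres greedily: keep the current centre while the chain length accumulated since it stays `< r`, else open a new
centre at the current point.  Every state `X_m` (face-connected, `≤ s₀` blocks, hence of sup-diameter `≤ s₀ − 1` —
`dist_le_card_sub_one_of_linked`) then lies in the sup-ball of radius `R = r + s₀ − 1` about the centre active at `y_m`,
a new centre is opened only after `≥ r` of chain length, and a sup-ball of radius `R` holds `(2R+1)^d` blocks.  Hence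
(`card_union_wunion_le`, `card_wunion_le`) `#X(□,ω) ≤ (2R+1)^d·(1 + wdist/r)`, and with `𝓛 ≤ # − 1`
(`TreeLength.treeLen_le_card_sub_one`): `M·𝓛(X(□,ω)) ≤ ((2R+1)^d/r)·(M·wdist) + M·((2R+1)^d − 1)` — `RescaleLaw` with
`Λ = (2R+1)^d/r`, `ℓ₀ = 0`, `ℓ₁ = (2R+1)^d − 1` (`rescaleLaw_tube`; at `r = s₀`: `Λ = (4s₀−1)^d/s₀ = O(s₀^{d−1})`,
`ℓ₁ = (4s₀−1)^d − 1 = O(s₀^d)` — the orders recorded in C-b10g12-1 (b), `rescaleLaw_tube_s₀`).  Then `B10Eq25Rate.bound25_of_bound23`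
with n08-b's adjacency count, anchor count and volume law gives (25) with rate `κ − 1` for EVERY `κ ≥ 0` and every
`M₁ ≥ max(2κΛ/δ₀, 2·s₀·animalBound·c)` — the second threshold κ-FREE (`bound25_tube`).

WHAT IS HERE (all PROVED; window `B ⊂ ℤ^d` of big blocks, states = face-connected families of `≤ s₀` blocks, as in
`B10Eq25WalkGeometry`; any `d`, any `r ≥ 1`).  §1 sup-balls of the block lattice (`ballFin`, `card_ballFin`,
`mem_ballFin_of_dist_le`); §2 the sup-diameter of a chain-connected family (`exists_mem_apply_eq_of_linked`,
`dist_le_card_sub_one_of_linked`); §3 the walk distance (3.93) (`wdist`, `wdist_nonneg`, `exists_wdist_cons_eq`);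
§4 the tube count; §5 the tube law (T) as `RescaleLaw`; §6 (23) ⇒ (25) on the window with (T).

HONEST SCOPE.  (i) (T) is a located READING of the cell (C-b10g12-1, info-grade), not a printed claim: print says only
«κ can be arbitrarily large if M₁ is sufficiently large», which (N) already delivers with `κ = O(log M₁)`; (T) delivers it
with `κ` linear in `M₁`.  (ii) The walk distance is the chain form (3.93) of [5] anchored at the term's block `□` with free
end (B10's wording «the length of a shortest tree graph passing through □ᵢ, □ⱼ, {X_m}» is, for one-line terms, bounded
below by it up to the last leg; `WalkTermBound23` is a hypothesis stated with the SAME `wd`, so the choice is a convention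
of the (23) binder, not an assertion).  (iii) sup-metric block units (print: «distance between centers of neighbouring
blocks … equal to 1»); (iv) free-boundary window, states sharing a block, `d` free, nothing of the expansion ∕ (23) ∕ (41)
∕ (5) — exactly as `B10Eq25WalkGeometry`.  No `def … : Prop` is minted; 0 sorry; axioms standard.
-/

noncomputable section

namespace Literature.MathematicalPhysics.QuantumFieldTheory.Balaban1983to89.B10Eq25TubeLaw

open B13ScaleTransfer (Pt Adj StepIn Linked FaceConnected)
open TreeLength (treeLen treeLen_le_card_sub_one treeLen_nonneg)
open TreeLengthCubeSystem (IsDom sys Cell sys_dj)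
open B10Eq25WalkGeometry (State nbrs single domOf wunion wunion_nil wunion_cons walk_props domOf_val animalBound
  card_nbrs_le card_anchors_le_one single_mem_cubesQ_domOf cubesQ volBoundK1_window)
open B10Eq25Rate (WalkTermBound23 RescaleLaw activitiesOf bound25_of_bound23)

variable {d : ℕ}

/-! ## §1 Sup-balls of the block lattice and their cardinality -/

section Balls

/-- The blocks at sup-distance `≤ R` from the block `c`: the box `∏_i [c_i − R, c_i + R]` of block indices
(the pattern of `B13ScaleTransfer.block`, radius `R`). [folklore] -/
def ballFin (c : Pt d) (R : ℕ) : Finset (Pt d) :=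
  Fintype.piFinset fun i => Finset.Icc (c i - R) (c i + R)

/-- The sup-ball of radius `R` holds exactly `(2R+1)^d` blocks. [folklore] -/
private theorem card_ballFin (c : Pt d) (R : ℕ) : (ballFin c R).card = (2 * R + 1) ^ d := by
  unfold ballFin
  rw [Fintype.card_piFinset]
  have h : ∀ i : Fin d, (Finset.Icc (c i - R) (c i + R)).card = 2 * R + 1 := fun i => by
    rw [Int.card_Icc]; omega
  simp_rw [h, Finset.prod_const, Finset.card_univ, Fintype.card_fin]

/-- A block at sup-distance `≤ R` from `c` lies in `ballFin c R`. [folklore] -/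
private theorem mem_ballFin_of_dist_le {c z : Pt d} {R : ℕ} (h : dist z c ≤ (R : ℝ)) : z ∈ ballFin c R := by
  rw [ballFin, Fintype.mem_piFinset]
  intro i
  have hi : dist (z i) (c i) ≤ (R : ℝ) := (dist_le_pi_dist z c i).trans h
  rw [Int.dist_eq, abs_le] at hi
  obtain ⟨h1, h2⟩ := hi
  have h1' : c i - (R : ℤ) ≤ z i := by exact_mod_cast (by linarith : ((c i : ℝ)) - R ≤ z i)
  have h2' : z i ≤ c i + (R : ℤ) := by exact_mod_cast (by linarith : (z i : ℝ) ≤ c i + R)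
  exact Finset.mem_Icc.mpr ⟨h1', h2'⟩

/-- Hence a family of blocks all within sup-distance `R` of `c` has at most `(2R+1)^d` members. [folklore] -/
private theorem card_le_of_dist_le {c : Pt d} {R : ℕ} {E : Finset (Pt d)} (h : ∀ e ∈ E, dist e c ≤ (R : ℝ)) :
    E.card ≤ (2 * R + 1) ^ d := by
  rw [← card_ballFin c R]
  exact Finset.card_le_card fun e he => mem_ballFin_of_dist_le (h e he)

end Balls

/-! ## §2 The sup-diameter of a chain-connected family of blocks -/

section Diameter

/-- Along a chain of wall-adjacent blocks inside `S` from `x` to `y`, the `i`-th coordinates of the blocks of `S` cover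
every integer between `x i` and `y i` (each step changes one coordinate by one). [folklore] -/
private theorem exists_mem_apply_eq_of_linked {S : Finset (Pt d)} {x y : Pt d} (hx : x ∈ S) (h : Linked S x y) (i : Fin d) :
    ∀ t : ℤ, min (x i) (y i) ≤ t → t ≤ max (x i) (y i) → ∃ w ∈ S, w i = t := by
  unfold Linked at h
  induction h with
  | refl =>
      intro t h1 h2
      exact ⟨x, hx, by omega⟩
  | @tail b c _ hbc ih =>
      intro t h1 h2
      obtain ⟨-, hcS, j, hj⟩ := hbc
      -- the new block differs from the previous one by one unit in one coordinate
      have hcoord : c i = b i ∨ c i = b i + 1 ∨ c i + 1 = b i := by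
        rcases hj with hj | hj
        · by_cases hji : j = i
          · subst hji; right; left; rw [hj]; simp
          · left; rw [hj]; simp [Function.update_of_ne (Ne.symm hji)]
        · by_cases hji : j = i
          · subst hji; right; right; rw [hj]; simp
          · left
            have : b i = c i := by rw [hj]; simp [Function.update_of_ne (Ne.symm hji)]
            exact this.symm
      by_cases ht : min (x i) (b i) ≤ t ∧ t ≤ max (x i) (b i)
      · exact ih t ht.1 ht.2
      · refine ⟨c, hcS, ?_⟩
        omega

/-- **The sup-diameter of a chain-connected family**: two blocks linked inside `S` are at sup-distance `≤ #S − 1` (their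
`i`-th coordinates span an interval of `|x i − y i| + 1` integers, each realised by a distinct block of `S`) — an elementary
property of the printed notion «connected family of cubes» of [Balaban1987RG1] p. 257 (NOT a printed display). [cite: Balaban1987RG1, p.257 (localization domains)] -/
theorem dist_le_card_sub_one_of_linked {S : Finset (Pt d)} {x y : Pt d} (hx : x ∈ S) (h : Linked S x y) :
    dist x y ≤ (S.card : ℝ) - 1 := by
  have hS : 0 < S.card := Finset.card_pos.mpr ⟨x, hx⟩
  have h0 : (0 : ℝ) ≤ (S.card : ℝ) - 1 := by
    have : (1 : ℝ) ≤ S.card := by exact_mod_cast hS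
    linarith
  refine (dist_pi_le_iff h0).mpr fun i => ?_
  -- the interval of `i`-th coordinates between `x i` and `y i` injects into `S`
  have hsub : Finset.Icc (min (x i) (y i)) (max (x i) (y i)) ⊆ S.image fun w => w i := by
    intro t ht
    rw [Finset.mem_Icc] at ht
    obtain ⟨w, hw, hwt⟩ := exists_mem_apply_eq_of_linked hx h i t ht.1 ht.2
    exact Finset.mem_image.mpr ⟨w, hw, hwt⟩
  have hcard := (Finset.card_le_card hsub).trans Finset.card_image_le
  rw [Int.card_Icc] at hcard
  have hZ : max (x i) (y i) + 1 - min (x i) (y i) ≤ (S.card : ℤ) := by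
    have h1 : (((max (x i) (y i) + 1 - min (x i) (y i)).toNat : ℕ) : ℤ) ≤ (S.card : ℤ) := by exact_mod_cast hcard
    rwa [Int.toNat_of_nonneg (by omega)] at h1
  have hA : (x i : ℝ) - y i ≤ (S.card : ℝ) - 1 := by
    have : x i - y i ≤ (S.card : ℤ) - 1 := by omega
    have := (Int.cast_le (R := ℝ)).mpr this
    push_cast at this
    exact this
  have hB : (y i : ℝ) - x i ≤ (S.card : ℝ) - 1 := by
    have : y i - x i ≤ (S.card : ℤ) - 1 := by omega
    have := (Int.cast_le (R := ℝ)).mpr this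
    push_cast at this
    exact this
  rw [Int.dist_eq]
  exact abs_sub_le_iff.mpr ⟨hA, hB⟩

/-- In a face-connected family («connected family of cubes», [Balaban1987RG1] p. 257) every two blocks are at
sup-distance `≤ # − 1` (elementary property of the printed notion, NOT a printed display). [cite: Balaban1987RG1, p.257 (localization domains)] -/
theorem dist_le_card_sub_one_of_faceConnected {S : Finset (Pt d)} (hS : FaceConnected S) {x y : Pt d} (hx : x ∈ S)
    (hy : y ∈ S) : dist x y ≤ (S.card : ℝ) - 1 :=
  dist_le_card_sub_one_of_linked hx (hS x hx y hy)

end Diameter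

/-! ## §3 The walk distance (3.93) of [5] through the states of a walk -/

section WalkDist

variable {B : Finset (Pt d)} {s₀ : ℕ}

/-- **(3.93) [5] p. 410** «d(ω, y, y′) = inf_{(y₁,…,yₙ)}(d(y, y₁) + d(y₁, y₂) + ⋯ + d(yₙ₋₁, yₙ) + d(yₙ, y′)), the infimum
is taken over all sequences (y₁, y₂, …, yₙ) of points yᵢ ∈ □ᵢ» — for a chain of walk states `ω = (X₁, …, Xₙ)` started at
the block `y`, with free end: the least sup-length of a chain `y, y₁ ∈ X₁, …, yₙ ∈ Xₙ` (block units), by the dynamic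
programme `wdist y (X :: ω) = min_{z ∈ X} (dist y z + wdist z ω)`. [cite: Balaban1985BackgroundPropagators, (3.93) p.410] -/
def wdist : Pt d → List (State B s₀) → ℝ
  | _, [] => 0
  | y, X :: ω => X.1.inf' X.2.1.2.1 fun z => dist y z + wdist z ω

/-- The walk distance of the empty chain is `0`. [cite: Balaban1985BackgroundPropagators, (3.93) p.410] -/
@[simp] theorem wdist_nil (y : Pt d) : wdist y ([] : List (State B s₀)) = 0 := rfl

/-- The recursion of the walk distance. [cite: Balaban1985BackgroundPropagators, (3.93) p.410] -/
theorem wdist_cons (y : Pt d) (X : State B s₀) (ω : List (State B s₀)) :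
    wdist y (X :: ω) = X.1.inf' X.2.1.2.1 fun z => dist y z + wdist z ω := rfl

/-- The walk distance is nonnegative. [cite: Balaban1985BackgroundPropagators, (3.93) p.410] -/
theorem wdist_nonneg : ∀ (y : Pt d) (ω : List (State B s₀)), 0 ≤ wdist y ω
  | y, [] => le_rfl
  | y, X :: ω => by
      rw [wdist_cons]
      exact Finset.le_inf' _ _ fun z _ => add_nonneg dist_nonneg (wdist_nonneg z ω)

/-- The infimum of (3.93) is attained: some block `z` of the first state realises the walk distance.
[cite: Balaban1985BackgroundPropagators, (3.93) p.410] -/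
theorem exists_wdist_cons_eq (y : Pt d) (X : State B s₀) (ω : List (State B s₀)) :
    ∃ z ∈ X.1, wdist y (X :: ω) = dist y z + wdist z ω := by
  rw [wdist_cons]
  exact Finset.exists_mem_eq_inf' X.2.1.2.1 _

/-- Passing through a prescribed block of the first state costs at least the walk distance.
[cite: Balaban1985BackgroundPropagators, (3.93) p.410] -/
theorem wdist_cons_le {y z : Pt d} {X : State B s₀} (hz : z ∈ X.1) (ω : List (State B s₀)) :
    wdist y (X :: ω) ≤ dist y z + wdist z ω := by
  rw [wdist_cons]
  exact Finset.inf'_le _ hz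

end WalkDist

/-! ## §4 The tube count: the blocks of a walk's localization against its walk distance -/

section Tube

variable {B : Finset (Pt d)} {s₀ : ℕ}

/-- Every block of a walk state lies within sup-distance `s₀ − 1` of any block of that state («connected unions of
several big blocks» — at most `s₀`, face-connected). [cite: Balaban1985UV3, p.262] -/
theorem dist_le_of_mem_state {X : State B s₀} {x z : Pt d} (hx : x ∈ X.1) (hz : z ∈ X.1) :
    dist x z ≤ (s₀ : ℝ) - 1 := by
  have h := dist_le_card_sub_one_of_faceConnected X.2.1.2.2 hx hz
  have hc : (X.1.card : ℝ) ≤ s₀ := by exact_mod_cast X.2.2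
  linarith

/-- **THE TUBE COUNT (greedy r-net invariant).**  For a chain of states `ω` started at the block `y`, a current centre `c`
with `dist c y ≤ a`, `0 ≤ a < r` (the chain length accumulated since `c` was opened), and any family `E` of blocks already
booked inside the sup-ball of radius `R = r + s₀ − 1` about `c`:
`#(E ∪ ⋃ω) ≤ (2R+1)^d · (1 + (wdist y ω + a)/r)` — folklore combinatorics behind the rescaling sentence of p. 262
(pub-balaban GAPS C-b10g12-1 (b); NOT a printed display). [cite: Balaban1985UV3, p.262 (before (25))] -/
theorem card_union_wunion_le (hs : 1 ≤ s₀) {r : ℕ} (hr : 1 ≤ r) :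
    ∀ (ω : List (State B s₀)) (y c : Pt d) (a : ℝ) (E : Finset (Pt d)),
      0 ≤ a → a < r → dist c y ≤ a → (∀ e ∈ E, dist e c ≤ ((r + s₀ - 1 : ℕ) : ℝ)) →
      ((E ∪ wunion ω).card : ℝ) ≤ ((2 * (r + s₀ - 1) + 1) ^ d : ℕ) * (1 + (wdist y ω + a) / r)
  | [], y, c, a, E, ha0, _, _, hE => by
      have hV : ((E ∪ wunion ([] : List (State B s₀))).card : ℝ) ≤ ((2 * (r + s₀ - 1) + 1) ^ d : ℕ) := by
        rw [wunion_nil, Finset.union_empty]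
        exact_mod_cast card_le_of_dist_le hE
      have hr0 : (0 : ℝ) < r := by exact_mod_cast hr
      have h1 : (1 : ℝ) ≤ 1 + (wdist y ([] : List (State B s₀)) + a) / r := by
        rw [wdist_nil, zero_add]
        have : 0 ≤ a / r := div_nonneg ha0 hr0.le
        linarith
      have hV0 : (0 : ℝ) ≤ ((2 * (r + s₀ - 1) + 1) ^ d : ℕ) := Nat.cast_nonneg _
      nlinarith
  | X :: ω, y, c, a, E, ha0, har, hcy, hE => by
      have hr0 : (0 : ℝ) < r := by exact_mod_cast hr
      have hRnat : ((r + s₀ - 1 : ℕ) : ℝ) = (r : ℝ) + s₀ - 1 := by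
        rw [Nat.cast_sub (by omega : 1 ≤ r + s₀)]; push_cast; ring
      set V : ℝ := (((2 * (r + s₀ - 1) + 1) ^ d : ℕ) : ℝ) with hVdef
      have hV0 : 0 ≤ V := Nat.cast_nonneg _
      obtain ⟨z, hz, hzeq⟩ := exists_wdist_cons_eq y X ω
      set ℓ : ℝ := dist y z with hℓdef
      have hℓ0 : 0 ≤ ℓ := dist_nonneg
      have hL'0 : 0 ≤ wdist z ω := wdist_nonneg z ω
      rw [wunion_cons, ← Finset.union_assoc]
      by_cases hcase : a + ℓ < r
      · -- keep the centre `c`: the state `X` lies in its ball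
        have hEX : ∀ e ∈ E ∪ X.1, dist e c ≤ ((r + s₀ - 1 : ℕ) : ℝ) := by
          intro e he
          rcases Finset.mem_union.mp he with he | he
          · exact hE e he
          · rw [hRnat]
            calc dist e c ≤ dist e z + dist z c := dist_triangle _ _ _
              _ ≤ ((s₀ : ℝ) - 1) + (dist z y + dist y c) := add_le_add (dist_le_of_mem_state he hz) (dist_triangle _ _ _)
              _ ≤ ((s₀ : ℝ) - 1) + (ℓ + a) := by rw [dist_comm z y, dist_comm y c]; linarith
              _ ≤ (r : ℝ) + s₀ - 1 := by linarith
        have hcz : dist c z ≤ a + ℓ := by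
          calc dist c z ≤ dist c y + dist y z := dist_triangle _ _ _
            _ ≤ a + ℓ := by linarith
        have ih := card_union_wunion_le hs hr ω z c (a + ℓ) (E ∪ X.1) (by linarith) hcase hcz hEX
        calc (((E ∪ X.1) ∪ wunion ω).card : ℝ) ≤ V * (1 + (wdist z ω + (a + ℓ)) / r) := ih
          _ = V * (1 + (wdist y (X :: ω) + a) / r) := by rw [hzeq]; ring
      · -- open a new centre at `z`
        push Not at hcase
        have hX : ∀ e ∈ X.1, dist e z ≤ ((r + s₀ - 1 : ℕ) : ℝ) := by
          intro e he
          rw [hRnat]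
          have := dist_le_of_mem_state he hz
          have hr1 : (1 : ℝ) ≤ r := by exact_mod_cast hr
          linarith
        have ih := card_union_wunion_le hs hr ω z z 0 X.1 le_rfl hr0 (by simp) hX
        have hEc : (E.card : ℝ) ≤ V := by rw [hVdef]; exact_mod_cast card_le_of_dist_le hE
        have hsplit : (((E ∪ X.1) ∪ wunion ω).card : ℝ) ≤ E.card + ((X.1 ∪ wunion ω).card : ℝ) := by
          rw [Finset.union_assoc]
          exact_mod_cast Finset.card_union_le _ _
        have hkey : V + V * (1 + (wdist z ω + 0) / r) ≤ V * (1 + (wdist y (X :: ω) + a) / r) := by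
          rw [hzeq, add_zero]
          have h1 : 1 ≤ (ℓ + a) / r := by rw [le_div_iff₀ hr0]; linarith
          have : V * (1 + (ℓ + wdist z ω + a) / r) = V + V * ((ℓ + a) / r + wdist z ω / r) := by ring
          rw [this]
          have : V * (1 + wdist z ω / r) ≤ V * ((ℓ + a) / r + wdist z ω / r) :=
            mul_le_mul_of_nonneg_left (by linarith) hV0
          linarith
        linarith

/-- **The blocks of a walk's localization against its walk distance**: `#(⋃ω) ≤ (2(r+s₀)−1)^d·(1 + wdist y ω / r)` for the
chain started at any block `y` (centre `y`, nothing booked) — the tube estimate of GAPS C-b10g12-1 (b) (NOT a printed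
display). [cite: Balaban1985UV3, p.262 (before (25))] -/
theorem card_wunion_le (hs : 1 ≤ s₀) {r : ℕ} (hr : 1 ≤ r) (ω : List (State B s₀)) (y : Pt d) :
    ((wunion ω).card : ℝ) ≤ ((2 * (r + s₀ - 1) + 1) ^ d : ℕ) * (1 + wdist y ω / r) := by
  have h := card_union_wunion_le hs hr ω y y 0 ∅ le_rfl (Nat.cast_pos.mpr hr) (by simp) (by simp)
  simpa using h

end Tube

/-! ## §5 The tube law (T) as `B10Eq25Rate.RescaleLaw` -/

section Law

variable {B : Finset (Pt d)} {s₀ : ℕ}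

/-- The walk distance of (23) in lattice units for the terms anchored at the block `□`: `d(ω, □, ·) = M·wdist □ ω`
(big blocks of side `M = M₁` lattice units). [cite: Balaban1985UV3, (23) p.262] -/
def wdT (M : ℝ) (b : Cell B) (ω : List (State B s₀)) : ℝ := M * wdist b.1 ω

/-- **THE TUBE LAW (T), PROVED on the window geometry** (pub-balaban GAPS C-b10g12-1 (b)): for every `r ≥ 1`, `M ≥ 0`,
`M·𝓛(X(□,ω)) ≤ ((2(r+s₀)−1)^d/r)·d(ω,□,·) + M·(0·|ω| + ((2(r+s₀)−1)^d − 1))` — `B10Eq25Rate.RescaleLaw` with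
`Λ = (2(r+s₀)−1)^d/r`, `ℓ₀ = 0`, `ℓ₁ = (2(r+s₀)−1)^d − 1`, for the concrete walk distance `wdT M`.
[cite: Balaban1985UV3, p.262 (before (25))] -/
theorem rescaleLaw_tube (hs : 1 ≤ s₀) {r : ℕ} (hr : 1 ≤ r) {M : ℝ} (hM : 0 ≤ M) :
    RescaleLaw (sys B) (nbrs B s₀) (single hs) (domOf hs) (wdT (s₀ := s₀) M) M
      ((((2 * (r + s₀ - 1) + 1) ^ d : ℕ) : ℝ) / r) 0 ((((2 * (r + s₀ - 1) + 1) ^ d : ℕ) : ℝ) - 1) := by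
  intro b n ω hω
  have hwd0 : 0 ≤ wdist b.1 ω := wdist_nonneg _ _
  refine ⟨mul_nonneg hM hwd0, ?_⟩
  rw [sys_dj, domOf_val hω, zero_mul, zero_add]
  obtain ⟨-, hdom, -⟩ := walk_props n (single hs b) ω hω
  have h1 : treeLen (wunion ω) ≤ ((wunion ω).card : ℝ) - 1 := treeLen_le_card_sub_one hdom.2.1 hdom.2.2
  have h2 := card_wunion_le hs hr ω b.1
  have hr0 : (0 : ℝ) < r := by exact_mod_cast hr
  set V : ℝ := (((2 * (r + s₀ - 1) + 1) ^ d : ℕ) : ℝ)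
  have hVe : V * (1 + wdist b.1 ω / r) - 1 = V / r * wdist b.1 ω + (V - 1) := by ring
  have h3 : treeLen (wunion ω) ≤ V / r * wdist b.1 ω + (V - 1) := by linarith
  calc M * treeLen (wunion ω) ≤ M * (V / r * wdist b.1 ω + (V - 1)) := mul_le_mul_of_nonneg_left h3 hM
    _ = V / r * wdT M b ω + M * (V - 1) := by unfold wdT; ring

/-- **The tube law at `r = s₀`**: `Λ = (4s₀−1)^d/s₀ = O(s₀^{d−1})`, `ℓ₀ = 0`, `ℓ₁ = (4s₀−1)^d − 1 = O(s₀^d)` — the orders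
recorded in GAPS C-b10g12-1 (b) («Λ = O(s₀²), ℓ₁ = O(s₀³)» at `d = 3`). [cite: Balaban1985UV3, p.262 (before (25))] -/
theorem rescaleLaw_tube_s₀ (hs : 1 ≤ s₀) {M : ℝ} (hM : 0 ≤ M) :
    RescaleLaw (sys B) (nbrs B s₀) (single hs) (domOf hs) (wdT (s₀ := s₀) M) M
      ((((4 * s₀ - 1) ^ d : ℕ) : ℝ) / s₀) 0 ((((4 * s₀ - 1) ^ d : ℕ) : ℝ) - 1) := by
  have h := rescaleLaw_tube (B := B) hs hs hM
  have e : 2 * (s₀ + s₀ - 1) + 1 = 4 * s₀ - 1 := by omega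
  rwa [e] at h

end Law

/-! ## §6 (23) ⇒ (25) on the window WITH THE TUBE LAW: rate linear in M₁, κ-free entropy threshold -/

section Assembly

variable {B : Finset (Pt d)} {s₀ : ℕ} {Φ : Type}

/-- **(23) ⇒ (25) ON THE WINDOW OF BIG BLOCKS WITH THE TUBE LAW** («With this definition we have (25) … where κ can be
arbitrarily large if M₁ is sufficiently large», read through «the exponential factor in (23)»): for the CONCRETE walk
distance `wdT M₁`, every `r ≥ 1`, every rate `κ ≥ 0` and every `M₁ > 0` with `2κΛ/δ₀ ≤ M₁` (Λ = (2(r+s₀)−1)^d/r — THE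
RATE IS LINEAR IN M₁) and the κ-FREE entropy threshold `2·(s₀·animalBound)·c ≤ M₁`, the analytic leaf (23)
`WalkTermBound23 (sys B) (nbrs B s₀) (single hs) (domOf hs) sp term (wdT M₁) (A₀g) C c M₁ δ₀` ALONE gives `B10.Bound25Printed`
for the regrouped terms `B10LogDet63.Elog` with rate `κ − 1` and `O(g₀) = (2A₀C·e^{κℓ₁}·4·2^d)·g₀`, `ℓ₁ = (2(r+s₀)−1)^d − 1` —
`B10Eq25Rate.bound25_of_bound23` with `hsc := rescaleLaw_tube` and n08-b's `card_nbrs_le`, `card_anchors_le_one`,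
`single_mem_cubesQ_domOf`, `volBoundK1_window` BY NAME. [cite: Balaban1985UV3, (23)–(25) p.262] -/
theorem bound25_tube (hs : 1 ≤ s₀) {r : ℕ} (hr : 1 ≤ r) {sp : (sys B).Dom → Set Φ}
    {term : Cell B → List (State B s₀) → Φ → ℂ} {A₀ C c M δ₀ κ g : ℝ} {R : Set Φ}
    (hM : 0 < M) (hA₀ : 0 ≤ A₀) (hC : 0 ≤ C) (hc : 0 ≤ c) (hδ₀ : 0 < δ₀) (hκ : 0 ≤ κ) (hg : 0 < g)
    (hMκ : 2 * κ * ((((2 * (r + s₀ - 1) + 1) ^ d : ℕ) : ℝ) / r) / δ₀ ≤ M)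
    (hMent : 2 * (((s₀ * animalBound d s₀ : ℕ) : ℝ) * c) ≤ M)
    (h23 : WalkTermBound23 (sys B) (nbrs B s₀) (single hs) (domOf hs) sp term (wdT (s₀ := s₀) M) (A₀ * g) C c M δ₀)
    (hR : ∀ X, R ⊆ sp X) :
    B10.Bound25Printed (activitiesOf (sys B) (B10LogDet63.Elog (nbrs B s₀) (single hs) (domOf hs) term) R) g (κ - 1)
      (2 * A₀ * C * Real.exp (κ * ((((2 * (r + s₀ - 1) + 1) ^ d : ℕ) : ℝ) - 1)) * (4 * 2 ^ d)) := by
  have hMent' : 2 * (((s₀ * animalBound d s₀ : ℕ) : ℝ) * (c * Real.exp (κ * 0))) ≤ M := by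
    simpa [Real.exp_zero] using hMent
  have h := bound25_of_bound23 (cubes := cubesQ hs) (Dg := s₀ * animalBound d s₀) (V := 1)
    (fun q => card_nbrs_le q) (fun q => card_anchors_le_one hs q)
    (fun b n ω hω => single_mem_cubesQ_domOf hs b n ω hω) hM hA₀ hC hc hδ₀ hκ hg hMκ hMent' h23
    (rescaleLaw_tube hs hr hM.le) (volBoundK1_window hs) hR
  simpa only [Nat.cast_one, mul_one] using h

end Assembly

end Literature.MathematicalPhysics.QuantumFieldTheory.Balaban1983to89.B10Eq25TubeLaw

end
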